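import Summits.CriticalPhenomena.PercolationContinuityZ3.Theorems.Transplant.FKConnectivityAllQPat3SPRecursion
import HarnessLib

/-!
# Connectivity correlation inequalities for `φ_{w,q}`, every `q > 0` — THEOREM SP: all marks inner; the parallel-case dispatch

Proof file (`--supports stmt-CriticalPhenomena-4575`), census lineage (gen 37) of LANE 2's FK sub-programme; builds on p205010
(kernel theorem, internal audit signed; external expert review pending).  No definitions, no named facts, no sorries.

Second half of census g37's structural recursion for THEOREM SP on two-terminal series–parallel networks (first half:
`…Pat3SPRecursion.lean`): `FK.pc_good` — a parallel composition `E₁ ∥ E₂` with unmarked terminals and all three marks inner in `E₁`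
(recursion on `|E₁|`; leaves type I / CORNER / `pb`; the mark-free part is never decomposed and no minor of it is needed) — and the
complete dispatch of the PARALLEL case of the main induction by the number of marked terminals: `FK.par_twoTerm` (both terminals
marked: `FK.spGood_parTwo`), `FK.par_oneTerm` (one: CORNER or `pb`), `FK.par_noTerm` (none: type I or `pc`), assembled in
`FK.spGood_parallel` (any placement of three distinct marks on a parallel composition).  Used by `…Pat3TheoremSP.lean`.
[cite: AyyerLinussonRavichandran2025, §7 (p. 22)] [cite: Grimmett2006, §3.8 (pp. 61–62)]
-/

namespace Summit.CriticalPhenomena.PercolationContinuityZ3.Theorems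

namespace FK

open SimpleGraph Literature.Probability.LatticeModels Literature.Probability.Percolation
open scoped Classical

variable {V : Type*} [Fintype V]

/-! ### All marks inner on one parallel part: the recursion `pc` -/

section AllInner

variable {F₁ F₂ E₂ : Finset (Sym2 V)} {x m y : V}

/-- All marks on the series part `F₁ ·ₘ F₂` with the junction `m` marked: re-rooted at `(m, x)` resp. `(m, y)` this is a CORNER
(marks on different blocks) or the one-marked-terminal configuration `pb` (marks on the same block). [cite: AyyerLinussonRavichandran2025, §7 (p. 22)] -/
theorem pc_junction {p q : V} (h₂ : IsTTSP E₂ x y) (hd : Disjoint (F₁ ∪ F₂) E₂)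
    (hV : ∀ z : V, (∃ e ∈ F₁ ∪ F₂, z ∈ e) → (∃ e ∈ E₂, z ∈ e) → z = x ∨ z = y)
    (hF₁ : IsTTSP F₁ x m) (hF₂ : IsTTSP F₂ m y) (hdF : Disjoint F₁ F₂)
    (hVF : ∀ z : V, (∃ e ∈ F₁, z ∈ e) → (∃ e ∈ F₂, z ∈ e) → z = m) (hxF₂ : ∀ e ∈ F₂, x ∉ e) (hyF₁ : ∀ e ∈ F₁, y ∉ e)
    (hp : ∃ e ∈ F₁ ∪ F₂, p ∈ e) (hq : ∃ e ∈ F₁ ∪ F₂, q ∈ e) (hpm : p ≠ m) (hpx : p ≠ x) (hpy : p ≠ y)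
    (hqm : q ≠ m) (hqx : q ≠ x) (hqy : q ≠ y) (hpq : p ≠ q) : SPGood (F₁ ∪ F₂ ∪ E₂) m p q := by
  obtain ⟨hA, hdA, hVA⟩ := reroot_serA h₂ hd hV hF₁ hF₂ hdF hVF hxF₂ hyF₁
  obtain ⟨hB, hdB, hVB⟩ := reroot_serB h₂ hd hV hF₁ hF₂ hdF hVF hxF₂ hyF₁
  have eA : F₁ ∪ (F₂ ∪ E₂) = F₁ ∪ F₂ ∪ E₂ := (Finset.union_assoc _ _ _).symm
  have eB : F₂ ∪ (F₁ ∪ E₂) = F₁ ∪ F₂ ∪ E₂ := by rw [← Finset.union_assoc, Finset.union_comm F₂ F₁]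
  rcases span_union hp with hp1 | hp2 <;> rcases span_union hq with hq1 | hq2
  · exact (pb_good F₁.card le_rfl hF₁.symm hA hdA hVA hp1 hq1 hpm hpx hqm hqx hpq).congr_edges eA
  · exact (spGood_corner hdA hVA hF₁.symm hA hp1 ⟨hq2.choose, Finset.mem_union_left _ hq2.choose_spec.1,
      hq2.choose_spec.2⟩ hpm hpx hqm hqx).congr_edges eA
  · exact (spGood_corner hdA hVA hF₁.symm hA hq1 ⟨hp2.choose, Finset.mem_union_left _ hp2.choose_spec.1,
      hp2.choose_spec.2⟩ hqm hqx hpm hpx).swap23.congr_edges eA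
  · exact (pb_good F₂.card le_rfl hF₂ hB hdB hVB hp2 hq2 hpm hpy hqm hqy hpq).congr_edges eB

/-- **ALL MARKS INNER ON ONE PART (census g37):** a parallel composition `E₁ ∥ E₂` of two-terminal series–parallel `(x, y)`-networks,
`x, y` unmarked, the three marks inner in `E₁`: `T_sym` and the three `STAR`s are levelwise nonnegative on `E₁ ∪ E₂`.  By recursion on
`|E₁|` through type-I / CORNER / `pb` leaves (the mark-free part `E₂` is never decomposed and no minor of it is needed).
[cite: AyyerLinussonRavichandran2025, §7 (p. 22)] -/
theorem pc_good : ∀ (n : ℕ) {E₁ E₂ : Finset (Sym2 V)} {x y b s t : V}, E₁.card ≤ n →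
    IsTTSP E₁ x y → IsTTSP E₂ x y → Disjoint E₁ E₂ →
    (∀ z : V, (∃ e ∈ E₁, z ∈ e) → (∃ e ∈ E₂, z ∈ e) → z = x ∨ z = y) →
    (∃ e ∈ E₁, b ∈ e) → (∃ e ∈ E₁, s ∈ e) → (∃ e ∈ E₁, t ∈ e) →
    b ≠ x → b ≠ y → s ≠ x → s ≠ y → t ≠ x → t ≠ y → b ≠ s → b ≠ t → s ≠ t → SPGood (E₁ ∪ E₂) b s t := by
  intro n
  induction n with
  | zero =>
    intro E₁ E₂ x y b s t hcard h₁ _ _ _ _ _ _ _ _ _ _ _ _ _ _ _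
    have := h₁.card_pos
    omega
  | succ n ih =>
    intro E₁ E₂ x y b s t hcard h₁ h₂ hd hV hb hs ht hbx hby hsx hsy htx hty hbs hbt hst
    cases h₁ with
    | edge hxy =>
      obtain ⟨e, he, hse⟩ := hs
      rw [Finset.mem_singleton] at he
      subst he
      rcases Sym2.mem_iff.1 hse with h | h
      · exact absurd h hsx
      · exact absurd h hsy
    | @parallel Q₁ Q₂ _ _ hQ₁ hQ₂ hdQ hVQ =>
      have hlt1 := card_left_lt_of_parallel hQ₂ hdQ
      have hlt2 := card_right_lt_of_parallel hQ₁ hdQ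
      obtain ⟨hP, hdP, hVP⟩ := reroot_par h₂ hd hV hQ₂ hdQ hVQ
      obtain ⟨hP', hdP', hVP'⟩ := reroot_par' h₂ hd hV hQ₁ hdQ hVQ
      have eA : Q₁ ∪ (Q₂ ∪ E₂) = Q₁ ∪ Q₂ ∪ E₂ := (Finset.union_assoc _ _ _).symm
      have eB : Q₂ ∪ (Q₁ ∪ E₂) = Q₁ ∪ Q₂ ∪ E₂ := by rw [← Finset.union_assoc, Finset.union_comm Q₂ Q₁]
      have l1 : ∀ {p : V}, (∃ e ∈ Q₁, p ∈ e) → ∃ e ∈ Q₁ ∪ E₂, p ∈ e := fun ⟨e, he, hpe⟩ =>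
        ⟨e, Finset.mem_union_left _ he, hpe⟩
      have l2 : ∀ {p : V}, (∃ e ∈ Q₂, p ∈ e) → ∃ e ∈ Q₂ ∪ E₂, p ∈ e := fun ⟨e, he, hpe⟩ =>
        ⟨e, Finset.mem_union_left _ he, hpe⟩
      rcases span_union hb with hb1 | hb2 <;> rcases span_union hs with hs1 | hs2 <;>
        rcases span_union ht with ht1 | ht2
      · exact (ih (by omega) hQ₁ hP hdP hVP hb1 hs1 ht1 hbx hby hsx hsy htx hty hbs hbt hst).congr_edges eA
      · exact (typeI_good _ le_rfl hQ₁ hP hdP hVP hb1 hs1 (l2 ht2) hbx hby hsx hsy htx hty hbs).rotate.congr_edges eA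
      · exact (typeI_good _ le_rfl hQ₁ hP hdP hVP hb1 ht1 (l2 hs2) hbx hby htx hty hsx hsy hbt).rotate.swap23.congr_edges
          eA
      · exact (typeI_good _ le_rfl hQ₂ hP' hdP' hVP' hs2 ht2 (l1 hb1) hsx hsy htx hty hbx hby hst).congr_edges eB
      · exact (typeI_good _ le_rfl hQ₁ hP hdP hVP hs1 ht1 (l2 hb2) hsx hsy htx hty hbx hby hst).congr_edges eA
      · exact (typeI_good _ le_rfl hQ₂ hP' hdP' hVP' hb2 ht2 (l1 hs1) hbx hby htx hty hsx hsy hbt).rotate.swap23.congr_edges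
          eB
      · exact (typeI_good _ le_rfl hQ₂ hP' hdP' hVP' hb2 hs2 (l1 ht1) hbx hby hsx hsy htx hty hbs).rotate.congr_edges eB
      · exact (ih (by omega) hQ₂ hP' hdP' hVP' hb2 hs2 ht2 hbx hby hsx hsy htx hty hbs hbt hst).congr_edges eB
    | @series F₁ F₂ _ m _ hF₁ hF₂ hdF hVF hxF₂ hyF₁ =>
      have hlt1 := card_left_lt_of_parallel hF₂ hdF
      have hlt2 := card_right_lt_of_parallel hF₁ hdF
      by_cases hbm : b = m
      · subst hbm
        exact pc_junction h₂ hd hV hF₁ hF₂ hdF hVF hxF₂ hyF₁ hs ht (Ne.symm hbs) hsx hsy (Ne.symm hbt) htx hty hst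
      by_cases hsm : s = m
      · subst hsm
        exact (pc_junction h₂ hd hV hF₁ hF₂ hdF hVF hxF₂ hyF₁ hb ht hbs hbx hby (Ne.symm hst) htx hty hbt).swap12
      by_cases htm : t = m
      · subst htm
        exact (pc_junction h₂ hd hV hF₁ hF₂ hdF hVF hxF₂ hyF₁ hb hs hbt hbx hby hst hsx hsy hbs).rotate
      obtain ⟨hA, hdA, hVA⟩ := reroot_serA h₂ hd hV hF₁ hF₂ hdF hVF hxF₂ hyF₁
      have hVA' : ∀ z : V, (∃ e ∈ F₁, z ∈ e) → (∃ e ∈ F₂ ∪ E₂, z ∈ e) → z = x ∨ z = m :=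
        fun z h1 h => (hVA z h1 h).symm
      obtain ⟨hB, hdB, hVB⟩ := reroot_serB h₂ hd hV hF₁ hF₂ hdF hVF hxF₂ hyF₁
      have eA : F₁ ∪ (F₂ ∪ E₂) = F₁ ∪ F₂ ∪ E₂ := (Finset.union_assoc _ _ _).symm
      have eB : F₂ ∪ (F₁ ∪ E₂) = F₁ ∪ F₂ ∪ E₂ := by rw [← Finset.union_assoc, Finset.union_comm F₂ F₁]
      have l1 : ∀ {p : V}, (∃ e ∈ F₁, p ∈ e) → ∃ e ∈ F₁ ∪ E₂, p ∈ e := fun ⟨e, he, hpe⟩ =>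
        ⟨e, Finset.mem_union_left _ he, hpe⟩
      have l2 : ∀ {p : V}, (∃ e ∈ F₂, p ∈ e) → ∃ e ∈ F₂ ∪ E₂, p ∈ e := fun ⟨e, he, hpe⟩ =>
        ⟨e, Finset.mem_union_left _ he, hpe⟩
      rcases span_union hb with hb1 | hb2 <;> rcases span_union hs with hs1 | hs2 <;>
        rcases span_union ht with ht1 | ht2
      · exact (ih (by omega) hF₁ hA.symm hdA hVA' hb1 hs1 ht1 hbx hbm hsx hsm htx htm hbs hbt hst).congr_edges eA
      · exact (typeI_good _ le_rfl hF₁ hA.symm hdA hVA' hb1 hs1 (l2 ht2) hbx hbm hsx hsm htx htm hbs).rotate.congr_edges eA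
      · exact (typeI_good _ le_rfl hF₁ hA.symm hdA hVA' hb1 ht1 (l2 hs2) hbx hbm htx htm hsx hsm
          hbt).rotate.swap23.congr_edges eA
      · exact (typeI_good _ le_rfl hF₂ hB hdB hVB hs2 ht2 (l1 hb1) hsm hsy htm hty hbm hby hst).congr_edges eB
      · exact (typeI_good _ le_rfl hF₁ hA.symm hdA hVA' hs1 ht1 (l2 hb2) hsx hsm htx htm hbx hbm hst).congr_edges eA
      · exact (typeI_good _ le_rfl hF₂ hB hdB hVB hb2 ht2 (l1 hs1) hbm hby htm hty hsm hsy
          hbt).rotate.swap23.congr_edges eB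
      · exact (typeI_good _ le_rfl hF₂ hB hdB hVB hb2 hs2 (l1 ht1) hbm hby hsm hsy htm hty hbs).rotate.congr_edges eB
      · exact (ih (by omega) hF₂ hB hdB hVB hb2 hs2 ht2 hbm hby hsm hsy htm hty hbs hbt hst).congr_edges eB

end AllInner

/-! ### The parallel case of the main induction, by the number of marked terminals -/

section ParallelCase

variable {Q₁ Q₂ : Finset (Sym2 V)} {x y : V}

/-- Both terminals marked, the third mark `r` inner. [cite: AyyerLinussonRavichandran2025, §7 (p. 22)] -/
theorem par_twoTerm {r : V} (hQ₁ : IsTTSP Q₁ x y) (hQ₂ : IsTTSP Q₂ x y) (hdQ : Disjoint Q₁ Q₂)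
    (hVQ : ∀ z : V, (∃ e ∈ Q₁, z ∈ e) → (∃ e ∈ Q₂, z ∈ e) → z = x ∨ z = y)
    (hr : ∃ e ∈ Q₁ ∪ Q₂, r ∈ e) (hrx : r ≠ x) (hry : r ≠ y) : SPGood (Q₁ ∪ Q₂) x y r := by
  rcases span_union hr with hr1 | hr2
  · exact (spGood_parTwo hdQ.symm (fun z h2 h1 => hVQ z h1 h2) hQ₁.ne hQ₁ hr1 hrx hry).congr_edges (Finset.union_comm _ _)
  · exact spGood_parTwo hdQ hVQ hQ₁.ne hQ₂ hr2 hrx hry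

/-- Exactly the terminal `x` marked, the other two marks `p, q` inner. [cite: AyyerLinussonRavichandran2025, §7 (p. 22)] -/
theorem par_oneTerm {p q : V} (hQ₁ : IsTTSP Q₁ x y) (hQ₂ : IsTTSP Q₂ x y) (hdQ : Disjoint Q₁ Q₂)
    (hVQ : ∀ z : V, (∃ e ∈ Q₁, z ∈ e) → (∃ e ∈ Q₂, z ∈ e) → z = x ∨ z = y)
    (hp : ∃ e ∈ Q₁ ∪ Q₂, p ∈ e) (hq : ∃ e ∈ Q₁ ∪ Q₂, q ∈ e) (hpx : p ≠ x) (hpy : p ≠ y) (hqx : q ≠ x) (hqy : q ≠ y)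
    (hpq : p ≠ q) : SPGood (Q₁ ∪ Q₂) x p q := by
  rcases span_union hp with hp1 | hp2 <;> rcases span_union hq with hq1 | hq2
  · exact pb_good Q₁.card le_rfl hQ₁ hQ₂ hdQ hVQ hp1 hq1 hpx hpy hqx hqy hpq
  · exact spGood_corner hdQ hVQ hQ₁ hQ₂ hp1 hq2 hpx hpy hqx hqy
  · exact (spGood_corner hdQ hVQ hQ₁ hQ₂ hq1 hp2 hqx hqy hpx hpy).swap23
  · exact (pb_good Q₂.card le_rfl hQ₂ hQ₁ hdQ.symm (fun z h2 h1 => hVQ z h1 h2) hp2 hq2 hpx hpy hqx hqy hpq).congr_edges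
      (Finset.union_comm _ _)

/-- No terminal marked: all three marks inner. [cite: AyyerLinussonRavichandran2025, §7 (p. 22)] -/
theorem par_noTerm {b s t : V} (hQ₁ : IsTTSP Q₁ x y) (hQ₂ : IsTTSP Q₂ x y) (hdQ : Disjoint Q₁ Q₂)
    (hVQ : ∀ z : V, (∃ e ∈ Q₁, z ∈ e) → (∃ e ∈ Q₂, z ∈ e) → z = x ∨ z = y)
    (hb : ∃ e ∈ Q₁ ∪ Q₂, b ∈ e) (hs : ∃ e ∈ Q₁ ∪ Q₂, s ∈ e) (ht : ∃ e ∈ Q₁ ∪ Q₂, t ∈ e)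
    (hbx : b ≠ x) (hby : b ≠ y) (hsx : s ≠ x) (hsy : s ≠ y) (htx : t ≠ x) (hty : t ≠ y)
    (hbs : b ≠ s) (hbt : b ≠ t) (hst : s ≠ t) : SPGood (Q₁ ∪ Q₂) b s t := by
  have hdQ' : Disjoint Q₂ Q₁ := hdQ.symm
  have hVQ' : ∀ z : V, (∃ e ∈ Q₂, z ∈ e) → (∃ e ∈ Q₁, z ∈ e) → z = x ∨ z = y := fun z h2 h1 => hVQ z h1 h2
  have eB : Q₂ ∪ Q₁ = Q₁ ∪ Q₂ := Finset.union_comm _ _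
  rcases span_union hb with hb1 | hb2 <;> rcases span_union hs with hs1 | hs2 <;> rcases span_union ht with ht1 | ht2
  · exact pc_good Q₁.card le_rfl hQ₁ hQ₂ hdQ hVQ hb1 hs1 ht1 hbx hby hsx hsy htx hty hbs hbt hst
  · exact (typeI_good Q₁.card le_rfl hQ₁ hQ₂ hdQ hVQ hb1 hs1 ht2 hbx hby hsx hsy htx hty hbs).rotate
  · exact (typeI_good Q₁.card le_rfl hQ₁ hQ₂ hdQ hVQ hb1 ht1 hs2 hbx hby htx hty hsx hsy hbt).rotate.swap23
  · exact (typeI_good Q₂.card le_rfl hQ₂ hQ₁ hdQ' hVQ' hs2 ht2 hb1 hsx hsy htx hty hbx hby hst).congr_edges eB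
  · exact typeI_good Q₁.card le_rfl hQ₁ hQ₂ hdQ hVQ hs1 ht1 hb2 hsx hsy htx hty hbx hby hst
  · exact (typeI_good Q₂.card le_rfl hQ₂ hQ₁ hdQ' hVQ' hb2 ht2 hs1 hbx hby htx hty hsx hsy hbt).rotate.swap23.congr_edges eB
  · exact (typeI_good Q₂.card le_rfl hQ₂ hQ₁ hdQ' hVQ' hb2 hs2 ht1 hbx hby hsx hsy htx hty hbs).rotate.congr_edges eB
  · exact (pc_good Q₂.card le_rfl hQ₂ hQ₁ hdQ' hVQ' hb2 hs2 ht2 hbx hby hsx hsy htx hty hbs hbt hst).congr_edges eB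

/-- One marked terminal `x` and two further distinct marks placed anywhere else (the other terminal allowed).
[cite: AyyerLinussonRavichandran2025, §7 (p. 22)] -/
theorem par_termFirst {p q : V} (hQ₁ : IsTTSP Q₁ x y) (hQ₂ : IsTTSP Q₂ x y) (hdQ : Disjoint Q₁ Q₂)
    (hVQ : ∀ z : V, (∃ e ∈ Q₁, z ∈ e) → (∃ e ∈ Q₂, z ∈ e) → z = x ∨ z = y)
    (hp : ∃ e ∈ Q₁ ∪ Q₂, p ∈ e) (hq : ∃ e ∈ Q₁ ∪ Q₂, q ∈ e) (hpx : p ≠ x) (hqx : q ≠ x) (hpq : p ≠ q) :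
    SPGood (Q₁ ∪ Q₂) x p q := by
  by_cases hpy : p = y
  · subst hpy
    exact (par_twoTerm hQ₁ hQ₂ hdQ hVQ hq hqx (Ne.symm hpq)).swap23.swap23
  by_cases hqy : q = y
  · subst hqy
    exact (par_twoTerm hQ₁ hQ₂ hdQ hVQ hp hpx hpy).swap23
  exact par_oneTerm hQ₁ hQ₂ hdQ hVQ hp hq hpx hpy hqx hqy hpq

/-- **THE PARALLEL CASE:** on a parallel composition of two two-terminal series–parallel networks, every placement of three
distinct marks is good (no induction hypothesis needed). [cite: AyyerLinussonRavichandran2025, §7 (p. 22)] -/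
theorem spGood_parallel {b s t : V} (hQ₁ : IsTTSP Q₁ x y) (hQ₂ : IsTTSP Q₂ x y) (hdQ : Disjoint Q₁ Q₂)
    (hVQ : ∀ z : V, (∃ e ∈ Q₁, z ∈ e) → (∃ e ∈ Q₂, z ∈ e) → z = x ∨ z = y)
    (hb : ∃ e ∈ Q₁ ∪ Q₂, b ∈ e) (hs : ∃ e ∈ Q₁ ∪ Q₂, s ∈ e) (ht : ∃ e ∈ Q₁ ∪ Q₂, t ∈ e)
    (hbs : b ≠ s) (hbt : b ≠ t) (hst : s ≠ t) : SPGood (Q₁ ∪ Q₂) b s t := by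
  -- the data are symmetric under `x ↔ y`
  have hVQ' : ∀ z : V, (∃ e ∈ Q₁, z ∈ e) → (∃ e ∈ Q₂, z ∈ e) → z = y ∨ z = x := fun z h1 h2 => (hVQ z h1 h2).symm
  by_cases hbx : b = x
  · subst hbx
    exact par_termFirst hQ₁ hQ₂ hdQ hVQ hs ht (Ne.symm hbs) (Ne.symm hbt) hst
  by_cases hby : b = y
  · subst hby
    exact par_termFirst hQ₁.symm hQ₂.symm hdQ hVQ' hs ht (Ne.symm hbs) (Ne.symm hbt) hst
  by_cases hsx : s = x
  · subst hsx
    exact (par_termFirst hQ₁ hQ₂ hdQ hVQ hb ht hbx (Ne.symm hst) hbt).swap12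
  by_cases hsy : s = y
  · subst hsy
    exact (par_termFirst hQ₁.symm hQ₂.symm hdQ hVQ' hb ht hby (Ne.symm hst) hbt).swap12
  by_cases htx : t = x
  · subst htx
    exact (par_termFirst hQ₁ hQ₂ hdQ hVQ hb hs hbx hsx hbs).rotate
  by_cases hty : t = y
  · subst hty
    exact (par_termFirst hQ₁.symm hQ₂.symm hdQ hVQ' hb hs hby hsy hbs).rotate
  exact par_noTerm hQ₁ hQ₂ hdQ hVQ hb hs ht hbx hby hsx hsy htx hty hbs hbt hst

end ParallelCase


end FK

end Summit.CriticalPhenomena.PercolationContinuityZ3.Theorems
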